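import Literature.Analysis.FluidPDE.StationaryEulerTorusGrid
import HarnessLib

/-!
# Smooth strict subsolutions on the torus (Choffrut–Székelyhidi 2014, §2, Steps 1–2)

Topic `Literature/Analysis/FluidPDE`. Support file of the proof of
`Literature.Analysis.FluidPDE.Torus.ChoffrutSzekelyhidi2014_thm1` (Choffrut–Székelyhidi, SIAM
J. Math. Anal. 46 (2014) = arXiv:1401.4301), §2 "Proof of Theorem 1 assuming (P) and (*)":

* `IsTorusSub` is linear (`IsTorusSub.add`);
* the space `X₀` of smooth strict subsolutions (`MemX0 𝓕 e w`: `w` smooth, a weak subsolution,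
  `w(x) ∈ 𝒰_{e(x)}` for all `x`), its pointwise bounds, and the defect
  `J(w) = ∫ (e - |v|²) ≥ 0`;
* **Step 2 of the paper**: the state `w₀ = (v₀, v₀ ⊗ v₀ - |v₀|²/d Id)` of a smooth stationary
  Euler flow is a smooth weak subsolution with `w₀(x) ∈ 𝒦_{|v₀(x)|²} ⊆ 𝒰_{e(x)}` whenever
  `e > |v₀|²` (`memX0_eulerState`);
* two tools for Step 3: uniform joint margins of compact subsets of `{(r, w) : w ∈ 𝒰_r}`
  (`RelaxedFamily.exists_jmargin`) and the re-boxing of a packet supported in a rotated unit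
  cube into the axis cube `(0,1)^d` with almost the same energy (`exists_boxed`).

## References

* A. Choffrut, L. Székelyhidi Jr., SIAM J. Math. Anal. 46 (2014), §2, Steps 1–3, Lemma 2.
-/

noncomputable section

open scoped InnerProductSpace ContDiff ENNReal Matrix
open Set Function MeasureTheory Metric
open Literature.Analysis.FunctionSpaces

namespace Literature.Analysis.FluidPDE

namespace StationaryEuler

variable {d : Type*} [Fintype d] [DecidableEq d]

/-! ## Smoothness of state-valued maps on the torus -/

omit [DecidableEq d] in
/-- Coordinates of smooth state fields are smooth. [folklore] -/
theorem isSmooth_coord {w : UnitAddTorus d → State d} (hw : Torus.IsSmooth w) (c : Idx d) :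
    Torus.IsSmooth fun x => w x c :=
  hw.comp_clm (EuclideanSpace.proj c)

omit [DecidableEq d] in
/-- A state field is smooth iff all its coordinates are. [folklore] -/
theorem isSmooth_iff_coord {w : UnitAddTorus d → State d} : Torus.IsSmooth w ↔ ∀ c, Torus.IsSmooth fun x => w x c := by
  constructor
  · exact fun hw c => isSmooth_coord hw c
  · intro h
    unfold Torus.IsSmooth at h ⊢
    exact contDiff_euclidean.2 fun c => h c

omit [DecidableEq d] in
/-- A vector field on the torus is smooth iff all its coordinates are. [folklore] -/
theorem isSmooth_iff_apply {u : UnitAddTorus d → Ed d} : Torus.IsSmooth u ↔ ∀ i, Torus.IsSmooth fun x => u x i := by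
  constructor
  · exact fun hu i => hu.apply i
  · intro h
    unfold Torus.IsSmooth at h ⊢
    exact contDiff_euclidean.2 fun i => h i

omit [DecidableEq d] in
/-- Velocity coordinates of smooth state fields are smooth. [folklore] -/
theorem isSmooth_vel_apply {w : UnitAddTorus d → State d} (hw : Torus.IsSmooth w) (i : d) :
    Torus.IsSmooth fun x => vel (w x) i :=
  isSmooth_coord hw (Sum.inl i)

omit [DecidableEq d] in
/-- The velocity of a smooth state field is smooth. [folklore] -/
theorem isSmooth_vel {w : UnitAddTorus d → State d} (hw : Torus.IsSmooth w) : Torus.IsSmooth fun x => vel (w x) :=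
  isSmooth_iff_apply.2 fun i => isSmooth_vel_apply hw i

omit [DecidableEq d] in
/-- Stress coordinates of smooth state fields are smooth. [folklore] -/
theorem isSmooth_str_apply {w : UnitAddTorus d → State d} (hw : Torus.IsSmooth w) (i j : d) :
    Torus.IsSmooth fun x => str (w x) i j :=
  isSmooth_coord hw (Sum.inr (i, j))

omit [DecidableEq d] in
/-- Finite sums of smooth functions are smooth. [folklore] -/
theorem isSmooth_finsetSum {ι : Type*} {F : Type*} [NormedAddCommGroup F] [NormedSpace ℝ F] (s : Finset ι)
    {f : ι → UnitAddTorus d → F} (hf : ∀ i ∈ s, Torus.IsSmooth (f i)) : Torus.IsSmooth fun x => ∑ i ∈ s, f i x := by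
  unfold Torus.IsSmooth at hf ⊢
  have : Torus.lift (fun x => ∑ i ∈ s, f i x) = fun y => ∑ i ∈ s, Torus.lift (f i) y := by
    funext y; simp [Torus.lift_apply]
  rw [this]
  exact ContDiff.sum fun i hi => hf i hi

/-! ## Linearity of the weak subsolution identities -/

/-- **`IsTorusSub` is additive** on smooth fields. [folklore] -/
theorem IsTorusSub.add {w W : UnitAddTorus d → State d} (hw : Torus.IsSmooth w) (hW : Torus.IsSmooth W)
    (h1 : IsTorusSub w) (h2 : IsTorusSub W) : IsTorusSub fun x => w x + W x := by
  constructor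
  · intro θ hθ
    have hA : Integrable fun x => ∑ i, vel (w x) i * Torus.partialDeriv i θ x :=
      (isSmooth_finsetSum _ fun i _ => isSmooth_mul' (isSmooth_vel_apply hw i) (hθ.partialDeriv i)).integrable
    have hB : Integrable fun x => ∑ i, vel (W x) i * Torus.partialDeriv i θ x :=
      (isSmooth_finsetSum _ fun i _ => isSmooth_mul' (isSmooth_vel_apply hW i) (hθ.partialDeriv i)).integrable
    have hsplit : (fun x => ∑ i, vel (w x + W x) i * Torus.partialDeriv i θ x) =
        fun x => (∑ i, vel (w x) i * Torus.partialDeriv i θ x) + ∑ i, vel (W x) i * Torus.partialDeriv i θ x := by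
      funext x
      rw [← Finset.sum_add_distrib]
      exact Finset.sum_congr rfl fun i _ => by rw [vel_add, PiLp.add_apply]; ring
    rw [hsplit, integral_add hA hB, h1.1 θ hθ, h2.1 θ hθ, add_zero]
  · intro Φ hΦ hdiv
    have hA : Integrable fun x => ∑ i, ∑ j, str (w x) i j * Torus.partialDeriv j (fun y => Φ y i) x :=
      (isSmooth_finsetSum _ fun i _ => isSmooth_finsetSum _ fun j _ =>
        isSmooth_mul' (isSmooth_str_apply hw i j) ((hΦ.apply i).partialDeriv j)).integrable
    have hB : Integrable fun x => ∑ i, ∑ j, str (W x) i j * Torus.partialDeriv j (fun y => Φ y i) x :=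
      (isSmooth_finsetSum _ fun i _ => isSmooth_finsetSum _ fun j _ =>
        isSmooth_mul' (isSmooth_str_apply hW i j) ((hΦ.apply i).partialDeriv j)).integrable
    have hsplit : (fun x => ∑ i, ∑ j, str (w x + W x) i j * Torus.partialDeriv j (fun y => Φ y i) x) =
        fun x => (∑ i, ∑ j, str (w x) i j * Torus.partialDeriv j (fun y => Φ y i) x) +
          ∑ i, ∑ j, str (W x) i j * Torus.partialDeriv j (fun y => Φ y i) x := by
      funext x
      rw [← Finset.sum_add_distrib]
      refine Finset.sum_congr rfl fun i _ => ?_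
      rw [← Finset.sum_add_distrib]
      exact Finset.sum_congr rfl fun j _ => by rw [str_add, Matrix.add_apply]; ring
    rw [hsplit, integral_add hA hB, h1.2 Φ hΦ hdiv, h2.2 Φ hΦ hdiv, add_zero]

/-! ## The space `X₀` of smooth strict subsolutions -/

/-- **`w ∈ X₀`** (Step 1 of the paper): `w : T^d → ℝ^d × 𝒮^d_0` is smooth, a weak subsolution,
and `w(x) ∈ 𝒰_{e(x)}` for every `x`. [cite: ChoffrutSzekelyhidi2014, §2, Step 1] -/
structure MemX0 (𝓕 : RelaxedFamily d) (e : UnitAddTorus d → ℝ) (w : UnitAddTorus d → State d) : Prop where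
  /-- smoothness -/
  smooth : Torus.IsSmooth w
  /-- the weak subsolution identities -/
  sub : IsTorusSub w
  /-- strictness: values in the relaxed sets -/
  mem : ∀ x, w x ∈ 𝓕.U (e x)

namespace MemX0

variable {𝓕 : RelaxedFamily d} {e : UnitAddTorus d → ℝ} {w : UnitAddTorus d → State d}

/-- Values of `X₀` fields lie in `𝒦^{co}_{e(x)}`. [folklore] -/
theorem mem_C (h : MemX0 𝓕 e w) (x : UnitAddTorus d) : w x ∈ C (e x) := 𝓕.subset_C _ (h.mem x)

/-- Values of `X₀` fields are admissible. [folklore] -/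
theorem isAdm (h : MemX0 𝓕 e w) (x : UnitAddTorus d) : IsAdm (w x) := (h.mem_C x).1

/-- `X₀` fields are continuous. [folklore] -/
theorem continuous (h : MemX0 𝓕 e w) : Continuous w := h.smooth.continuous

variable [Nonempty d]

/-- `|v(x)|² ≤ e(x)` on `X₀`. [cite: ChoffrutSzekelyhidi2014, §2, Step 1] -/
theorem norm_vel_sq_le (h : MemX0 𝓕 e w) (x : UnitAddTorus d) : ‖vel (w x)‖ ^ 2 ≤ e x :=
  norm_vel_sq_le_of_mem_C (h.mem_C x)

/-- The energy profile is non-negative along `X₀` (the relaxed sets are empty for `r < 0`). [folklore] -/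
theorem nonneg (h : MemX0 𝓕 e w) (x : UnitAddTorus d) : 0 ≤ e x := nonneg_of_mem_C (h.mem_C x)

/-- **`X₀` is bounded in `L^∞`**: `‖w(x)‖ ≤ √ē + 3 ē d` if `e ≤ ē`. [cite: ChoffrutSzekelyhidi2014, §2, Step 1] -/
theorem norm_le (h : MemX0 𝓕 e w) {ebar : ℝ} (he : ∀ x, e x ≤ ebar) (x : UnitAddTorus d) :
    ‖w x‖ ≤ Real.sqrt ebar + 3 * ebar * Fintype.card d := by
  have h1 := norm_le_of_mem_C (h.mem_C x)
  have h0 := h.nonneg x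
  calc ‖w x‖ ≤ Real.sqrt (e x) + 3 * e x * Fintype.card d := h1
    _ ≤ Real.sqrt ebar + 3 * ebar * Fintype.card d := by
        gcongr
        · exact he x
        · exact he x

end MemX0

/-- **The defect** `J(w) = ∫ (e(x) - |v(x)|²) dx` of a state field. [cite: ChoffrutSzekelyhidi2014, §2, Step 3] -/
def defect (e : UnitAddTorus d → ℝ) (w : UnitAddTorus d → State d) : ℝ := ∫ x, (e x - ‖vel (w x)‖ ^ 2)

/-- The defect is non-negative on `X₀`. [folklore] -/
theorem MemX0.defect_nonneg [Nonempty d] {𝓕 : RelaxedFamily d} {e : UnitAddTorus d → ℝ} {w : UnitAddTorus d → State d}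
    (h : MemX0 𝓕 e w) : 0 ≤ defect e w :=
  integral_nonneg fun x => sub_nonneg.2 (h.norm_vel_sq_le x)

/-! ## Step 2: smooth stationary Euler flows are in `X₀` -/

/-- The state `w₀(x) = (v(x), v(x) ⊗ v(x) - |v(x)|²/d Id)` of a velocity field.
[cite: ChoffrutSzekelyhidi2014, §2, Step 2] -/
def eulerState (v : UnitAddTorus d → Ed d) (x : UnitAddTorus d) : State d :=
  mkSt (v x) (tensorSelf (v x) - (‖v x‖ ^ 2 / Fintype.card d) • (1 : Matrix d d ℝ))

/-- The velocity of the Euler state. [folklore] -/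
@[simp] theorem vel_eulerState (v : UnitAddTorus d → Ed d) (x : UnitAddTorus d) : vel (eulerState v x) = v x :=
  vel_mkSt _ _

/-- The stress of the Euler state. [folklore] -/
theorem str_eulerState_apply (v : UnitAddTorus d → Ed d) (x : UnitAddTorus d) (i j : d) :
    str (eulerState v x) i j = v x i * v x j - if i = j then ‖v x‖ ^ 2 / Fintype.card d else 0 := by
  rw [eulerState, str_mkSt, Matrix.sub_apply, Matrix.smul_apply, Matrix.one_apply]
  simp [tensorSelf, Matrix.vecMulVec_apply]

/-- **`w₀(x) ∈ 𝒦_{|v(x)|²}`.** [cite: ChoffrutSzekelyhidi2014, §2, Step 2] -/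
theorem eulerState_mem_K (v : UnitAddTorus d → Ed d) (x : UnitAddTorus d) : eulerState v x ∈ K (‖v x‖ ^ 2) := by
  refine ⟨by rw [vel_eulerState], ?_⟩
  rw [vel_eulerState, eulerState, str_mkSt]

/-- The Euler state of a smooth field is smooth. [folklore] -/
theorem isSmooth_eulerState {v : UnitAddTorus d → Ed d} (hv : Torus.IsSmooth v) : Torus.IsSmooth (eulerState v) := by
  refine isSmooth_iff_coord.2 fun c => ?_
  rcases c with i | ⟨i, j⟩
  · have : (fun x => eulerState v x (Sum.inl i)) = fun x => v x i := funext fun x => by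
      rw [← vel_apply (eulerState v x) i, vel_eulerState]
    rw [this]; exact hv.apply i
  · have : (fun x => eulerState v x (Sum.inr (i, j))) = fun x => v x i * v x j - if i = j then ‖v x‖ ^ 2 / Fintype.card d else 0 :=
      funext fun x => by rw [← str_apply (eulerState v x) i j, str_eulerState_apply]
    rw [this]
    refine (isSmooth_mul' (hv.apply i) (hv.apply j)).sub ?_
    split_ifs
    · have : (fun x => ‖v x‖ ^ 2 / (Fintype.card d : ℝ)) = fun x => (Fintype.card d : ℝ)⁻¹ * ‖v x‖ ^ 2 := by
        funext x; ring
      rw [this]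
      exact isSmooth_mul' (Torus.isSmooth_const _) hv.norm_sq
    · exact Torus.isSmooth_const _

/-- Coordinates of the torus derivative of a vector field: `(DΦ(x) w)ᵢ = Σⱼ wⱼ ∂ⱼΦᵢ(x)`. [folklore] -/
theorem fderiv_apply_apply {Φ : UnitAddTorus d → Ed d} (hΦ : Torus.IsSmooth Φ) (x : UnitAddTorus d) (w : Ed d) (i : d) :
    Torus.fderiv Φ x w i = ∑ j, w j * Torus.partialDeriv j (fun y => Φ y i) x := by
  have hd : HasFDerivAt (Torus.liftAt Φ x) (Torus.fderiv Φ x) 0 :=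
    (((hΦ.liftAt x).differentiable (by simp)).differentiableAt).hasFDerivAt
  have h2 := ((EuclideanSpace.proj i).hasFDerivAt.comp (0 : Ed d) hd).fderiv
  have h3 : Torus.fderiv (fun y => Φ y i) x = (EuclideanSpace.proj i).comp (Torus.fderiv Φ x) := by
    rw [Torus.fderiv, ← h2]; rfl
  have h4 : Torus.fderiv Φ x w i = Torus.fderiv (fun y => Φ y i) x w := by rw [h3]; rfl
  rw [h4, Torus.fderiv_apply_eq_sum_partialDeriv ((hΦ.apply i).isContDiff (by simp))]
  simp [smul_eq_mul]

/-- **Step 2 of the paper: `w₀` is a weak subsolution.** For a smooth stationary Euler flow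
`(v, p)`: (i) `∫ Σᵢ vᵢ∂ᵢθ = -∫ θ div v = 0`; (ii) for smooth divergence-free `Φ`,
`∫ Σᵢⱼ (vᵢvⱼ - |v|²δᵢⱼ/d) ∂ⱼΦᵢ = ∫ ⟪v, DΦ[v]⟫ = -∫ ⟪Dv[v], Φ⟫ = ∫ ⟪∇p, Φ⟫ = -∫ p div Φ = 0`
(the transport identity `∫ D⟪v, Φ⟫[v] = 0` for divergence-free `v`).
[cite: ChoffrutSzekelyhidi2014, §2, Step 2] -/
theorem isTorusSub_eulerState {v : UnitAddTorus d → Ed d} {p : UnitAddTorus d → ℝ} (hv : Torus.IsSmooth v)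
    (hp : Torus.IsSmooth p) (hdiv : Torus.IsDivFree v) (hE : ∀ x, Torus.convect v v x + Torus.gradient p x = 0) :
    IsTorusSub (eulerState v) := by
  constructor
  · intro θ hθ
    have h1 : ∀ x, ∑ i, vel (eulerState v x) i * Torus.partialDeriv i θ x = ⟪v x, Torus.gradient θ x⟫_ℝ := by
      intro x
      rw [real_inner_comm, Torus.inner_gradient_left, Torus.fderiv_apply_eq_sum_partialDeriv (hθ.isContDiff (by simp)),
        vel_eulerState]
      simp only [smul_eq_mul]
    simp_rw [h1]
    rw [Torus.integral_inner_gradient_eq_neg_integral_mul_divergence_holds hv hθ]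
    simp [hdiv _]
  · intro Φ hΦ hΦdiv
    have hv1 : Torus.IsContDiff 1 v := hv.isContDiff (by simp)
    have hΦ1 : Torus.IsContDiff 1 Φ := hΦ.isContDiff (by simp)
    -- the integrand is `⟪v, DΦ[v]⟫ - (|v|²/d) div Φ = ⟪v, DΦ[v]⟫`
    have hpt : ∀ x, ∑ i, ∑ j, str (eulerState v x) i j * Torus.partialDeriv j (fun y => Φ y i) x =
        ⟪v x, Torus.convect v Φ x⟫_ℝ := by
      intro x
      have hsplit : ∀ i j, str (eulerState v x) i j * Torus.partialDeriv j (fun y => Φ y i) x =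
          v x i * (v x j * Torus.partialDeriv j (fun y => Φ y i) x) -
            (if i = j then ‖v x‖ ^ 2 / Fintype.card d * Torus.partialDeriv j (fun y => Φ y i) x else 0) := by
        intro i j; rw [str_eulerState_apply]; split_ifs <;> ring
      simp_rw [hsplit, Finset.sum_sub_distrib]
      have htr : ∑ i, ∑ j, (if i = j then ‖v x‖ ^ 2 / Fintype.card d * Torus.partialDeriv j (fun y => Φ y i) x else 0) = 0 := by
        simp_rw [Finset.sum_ite_eq, Finset.mem_univ, if_true, ← Finset.mul_sum]
        have := hΦdiv x
        rw [Torus.divergence] at this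
        rw [this, mul_zero]
      rw [htr, sub_zero, Torus.convect, PiLp.inner_apply]
      refine Finset.sum_congr rfl fun i _ => ?_
      rw [fderiv_apply_apply hΦ, ← Finset.mul_sum]
      simp only [RCLike.inner_apply, conj_trivial]
      ring
    simp_rw [hpt]
    -- transport identity for `θ = ⟪v, Φ⟫`
    have hT := Torus.integral_fderiv_apply_eq_zero_of_isDivFree hv (hv.inner hΦ) hdiv
    have hprod : ∀ x, Torus.fderiv (fun y => ⟪v y, Φ y⟫_ℝ) x (v x) =
        ⟪v x, Torus.convect v Φ x⟫_ℝ + ⟪Torus.convect v v x, Φ x⟫_ℝ := fun x => by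
      rw [Torus.fderiv_inner_apply hv1 hΦ1]; rfl
    simp_rw [hprod] at hT
    have hI1 : Integrable fun x => ⟪v x, Torus.convect v Φ x⟫_ℝ := (hv.inner (hv.convect hΦ)).integrable
    have hI2 : Integrable fun x => ⟪Torus.convect v v x, Φ x⟫_ℝ := ((hv.convect hv).inner hΦ).integrable
    rw [integral_add hI1 hI2] at hT
    -- the Euler equation: `⟪Dv[v], Φ⟫ = -⟪∇p, Φ⟫`, and `∫ ⟪∇p, Φ⟫ = -∫ p div Φ = 0`
    have hEul : ∀ x, ⟪Torus.convect v v x, Φ x⟫_ℝ = -⟪Φ x, Torus.gradient p x⟫_ℝ := fun x => by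
      rw [show Torus.convect v v x = -Torus.gradient p x from eq_neg_of_add_eq_zero_left (hE x), inner_neg_left,
        real_inner_comm]
    simp_rw [hEul, integral_neg] at hT
    rw [Torus.integral_inner_gradient_eq_neg_integral_mul_divergence_holds hΦ hp] at hT
    simp only [hΦdiv _, mul_zero, integral_zero, neg_zero, add_zero] at hT
    exact hT

/-- **Step 2 of the paper: `w₀ ∈ X₀`** for every family of relaxed sets with property (*) and every
smooth energy profile `e > |v₀|²`. [cite: ChoffrutSzekelyhidi2014, §2, Step 2] -/
theorem memX0_eulerState (𝓕 : RelaxedFamily d) {v : UnitAddTorus d → Ed d} {p : UnitAddTorus d → ℝ}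
    {e : UnitAddTorus d → ℝ} (hv : Torus.IsSmooth v) (hp : Torus.IsSmooth p) (hdiv : Torus.IsDivFree v)
    (hE : ∀ x, Torus.convect v v x + Torus.gradient p x = 0) (he : ∀ x, ‖v x‖ ^ 2 < e x) :
    MemX0 𝓕 e (eulerState v) where
  smooth := isSmooth_eulerState hv
  sub := isTorusSub_eulerState hv hp hdiv hE
  mem x := 𝓕.K_subset (sq_nonneg _) (he x) (eulerState_mem_K v x)

/-! ## Uniform joint margins -/

namespace RelaxedFamily

variable (𝓕 : RelaxedFamily d)

/-- **Uniform joint margin**: a compact subset `S ⊆ 𝒰_r` has a `δ > 0` such that every admissible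
state within `δ` of `S` lies in `𝒰_{r'}` for every `|r' - r| < δ` (Lebesgue number of the cover
of `S` by the balls of `RelaxedFamily.relOpen`). [folklore] -/
theorem exists_jmargin {r : ℝ} {S : Set (State d)} (hS : IsCompact S) (hSU : S ⊆ 𝓕.U r) :
    ∃ δ > 0, ∀ s ∈ S, ∀ r' w', |r' - r| < δ → IsAdm w' → dist w' s < δ → w' ∈ 𝓕.U r' := by
  choose ε hε hεU using fun s : S => 𝓕.relOpen r s.1 (hSU s.2)
  obtain ⟨t, ht⟩ := hS.elim_finite_subcover (fun s : S => ball (s : State d) (ε s / 2)) (fun s => isOpen_ball)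
    (fun s hs => mem_iUnion.2 ⟨⟨s, hs⟩, mem_ball_self (half_pos (hε _))⟩)
  by_cases hSe : S = ∅
  · exact ⟨1, one_pos, fun s hs => by simp [hSe] at hs⟩
  have htne : t.Nonempty := by
    obtain ⟨s, hs⟩ := Set.nonempty_iff_ne_empty.2 hSe
    obtain ⟨i, hi⟩ := mem_iUnion.1 (ht hs)
    obtain ⟨hi, _⟩ := mem_iUnion.1 hi
    exact ⟨i, hi⟩
  set δ : ℝ := t.inf' htne fun s => ε s / 2 with hδ
  have hδpos : 0 < δ := by
    rw [hδ, Finset.lt_inf'_iff]; exact fun s _ => half_pos (hε s)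
  refine ⟨δ, hδpos, fun s hs r' w' hr' hw' hd => ?_⟩
  obtain ⟨i, hi⟩ := mem_iUnion.1 (ht hs)
  obtain ⟨hit, hsi⟩ := mem_iUnion.1 hi
  have hεi : δ ≤ ε i / 2 := Finset.inf'_le _ hit
  have hsi' : dist s (i : State d) < ε i / 2 := mem_ball.1 hsi
  have h1 : dist w' (i : State d) < ε i := by
    have := dist_triangle w' s (i : State d)
    linarith
  have h2 : |r' - r| < ε i := by linarith [hε i]
  exact hεU i r' w' h2 hw' h1

end RelaxedFamily

/-! ## Re-boxing a packet into the axis cube -/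

omit [DecidableEq d] in
/-- The range of a packet field is compact. [folklore] -/
theorem isCompact_range_field [DecidableEq d] (P : Packet d) : IsCompact (range (Packet.field P)) :=
  (Packet.hasCompactSupport_field P).isCompact_range (Packet.continuous_field P)

/-- **Re-boxing**: a packet supported in a rotated unit cube `refCube F` can be replaced by a
packet supported in the axis cube `(0,1)^d` whose field takes only values of the original field
(or `0`) and whose energy is smaller by at most `ε`: fill `(0,1)^d` up to measure `ε'` by
`F`-aligned cubes of a fine mesh and place a rescaled copy in each.
[cite: ChoffrutSzekelyhidi2014, §2, Step 3 ("covering and rescaling")] -/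
theorem exists_boxed (F : Ed d ≃ₗᵢ[ℝ] Ed d) {P : Packet d} (hP : Packet.SuppIn (refCube F) P) {ε : ℝ} (hε : 0 < ε) :
    ∃ P' : Packet d, Packet.SuppIn (box d) P' ∧
      (∀ x, Packet.field P' x = 0 ∨ ∃ y, Packet.field P' x = Packet.field P y) ∧
      (∫ x, ‖Packet.field P x‖ ^ 2) - ε ≤ ∫ x, ‖Packet.field P' x‖ ^ 2 := by
  set E : ℝ := ∫ x, ‖Packet.field P x‖ ^ 2 with hE
  have hE0 : 0 ≤ E := integral_nonneg fun x => by positivity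
  set e' : ℝ := ε / (E + 1) with he'
  have he'0 : 0 < e' := by positivity
  have he'1 : e' * E ≤ ε := by
    rw [he', div_mul_eq_mul_div, div_le_iff₀ (by positivity)]; nlinarith
  have hfin : volume (box d) ≠ ⊤ := by rw [volume_box]; exact ENNReal.one_ne_top
  obtain ⟨m, hm0, S, hS_sub, hS_vol⟩ := exists_acubes_subset (R := F) isOpen_box hfin (ENNReal.ofReal_pos.2 he'0).ne' 0
  have hm : 0 < m := hm0
  have hcube : ∀ κ ∈ S, acube F m κ ⊆ box d := fun κ hκ => (acube_subset_acubeClosed m κ).trans (hS_sub κ hκ)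
  set P' : Packet d := placed F hm S (fun _ => P) with hP'
  refine ⟨P', (suppIn_placed F hm S fun _ _ => hP).mono (iUnion₂_subset hcube), fun x => ?_, ?_⟩
  · by_cases hx : ∃ κ ∈ S, x ∈ acube F m κ
    · obtain ⟨κ, hκ, hxκ⟩ := hx
      exact Or.inr ⟨_, field_placed_of_mem F hm S (fun _ _ => hP) hκ hxκ⟩
    · push Not at hx
      exact Or.inl (field_placed_of_not_mem F hm S (fun _ _ => hP) hx)
  · -- energy of the boxed packet: `#S m^{-d} E ≥ (1 - e') E`
    have hint : Integrable fun x => ‖Packet.field P' x‖ ^ 2 := integrable_sq_field _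
    have hU : ∫ x, ‖Packet.field P' x‖ ^ 2 = ∫ x in ⋃ κ ∈ S, acube F m κ, ‖Packet.field P' x‖ ^ 2 := by
      refine (setIntegral_eq_integral_of_forall_compl_eq_zero fun x hx => ?_).symm
      rw [field_placed_of_not_mem F hm S (fun _ _ => hP) fun κ hκ hxκ => hx (mem_iUnion₂.2 ⟨κ, hκ, hxκ⟩), norm_zero]
      norm_num
    have hsum : ∫ x in ⋃ κ ∈ S, acube F m κ, ‖Packet.field P' x‖ ^ 2 = ∑ κ ∈ S, ((m : ℝ)⁻¹) ^ Fintype.card d * E := by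
      rw [integral_biUnion_finset _ (fun κ _ => measurableSet_acube m κ) (fun κ _ κ' _ h => disjoint_acube hm h)
        fun κ _ => hint.integrableOn]
      refine Finset.sum_congr rfl fun κ hκ => ?_
      rw [setIntegral_congr_fun (measurableSet_acube m κ) fun x hx => by
        rw [field_placed_of_mem F hm S (fun _ _ => hP) hκ hx, show Packet.field P ((m : ℝ) • (x - corner F m κ)) =
          0 + Packet.field P ((m : ℝ) • (x - corner F m κ)) from (zero_add _).symm]]
      rw [setIntegral_sq_const_add F hm hP κ 0, norm_zero]; ring
    -- the covered volume
    have hm' : (0 : ℝ) < m := by exact_mod_cast hm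
    have hvolU : volume.real (⋃ κ ∈ S, acube F m κ) = S.card * ((m : ℝ)⁻¹) ^ Fintype.card d := by
      rw [measureReal_def, volume_biUnion_acube hm, ENNReal.toReal_mul, ENNReal.toReal_pow,
        ENNReal.toReal_ofReal (inv_nonneg.2 hm'.le)]
      simp
    have hcov : 1 - e' ≤ volume.real (⋃ κ ∈ S, acube F m κ) := by
      have hsub : (⋃ κ ∈ S, acube F m κ) ⊆ box d := iUnion₂_subset hcube
      have h2 : volume (box d \ ⋃ κ ∈ S, acube F m κ) ≤ ENNReal.ofReal e' := hS_vol.le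
      have h3 : (1 : ℝ≥0∞) ≤ volume (⋃ κ ∈ S, acube F m κ) + ENNReal.ofReal e' := by
        calc (1 : ℝ≥0∞) = volume (box d) := volume_box.symm
          _ ≤ volume ((⋃ κ ∈ S, acube F m κ) ∪ (box d \ ⋃ κ ∈ S, acube F m κ)) :=
              measure_mono fun x hx => by
                by_cases h : x ∈ ⋃ κ ∈ S, acube F m κ
                · exact Or.inl h
                · exact Or.inr ⟨hx, h⟩
          _ ≤ volume (⋃ κ ∈ S, acube F m κ) + volume (box d \ ⋃ κ ∈ S, acube F m κ) := measure_union_le _ _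
          _ ≤ _ := by gcongr
      have hfinU : volume (⋃ κ ∈ S, acube F m κ) ≠ ⊤ := ne_top_of_le_ne_top hfin (measure_mono hsub)
      have h4 := ENNReal.toReal_mono (ENNReal.add_ne_top.2 ⟨hfinU, ENNReal.ofReal_ne_top⟩) h3
      rw [ENNReal.toReal_one, ENNReal.toReal_add hfinU ENNReal.ofReal_ne_top, ENNReal.toReal_ofReal he'0.le] at h4
      rw [measureReal_def]; linarith
    rw [hU, hsum, Finset.sum_const, nsmul_eq_mul, ← mul_assoc, ← hvolU]
    have key : (1 - e') * E ≤ volume.real (⋃ κ ∈ S, acube F m κ) * E := mul_le_mul_of_nonneg_right hcov hE0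
    nlinarith [key, he'1]

end StationaryEuler

end Literature.Analysis.FluidPDE
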